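import Literature.Analysis.FluidPDE.SteadyStrainedNS
import Literature.Analysis.FluidPDE.AxisymNoSwirlScalarEq
import HarnessLib

/-!
# Strained azimuthal flows `U_s + q(ρ) J x`: the steady Navier–Stokes computation

Analysis/FluidPDE proofs file (work item `defn-BurgersVortexInStrain`; all results proved). For the
axisymmetric strain `U_s = A x`, `A = diag(−γ/2, −γ/2, γ)` (`axisymmetricStrain γ`) and an azimuthal
perturbation `v(x) = q(ρ(x)) J x`, `ρ = x₀² + x₁²`, `J = rotGen` (so `v = v_θ(r) e_θ` with
`v_θ = r q(r²)`), we compute in Cartesian form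

* `Dv(x)h = 2q'(ρ)⟪x_h, h⟫ Jx + q(ρ) Jh` (`fderiv_azimuthal_apply`), hence `div (U_s + v) = 0` and
  `((U_s+v)·∇)(U_s+v) = A²x − γ(q + ρq')(ρ) Jx − q(ρ)² x_h`
  (`AJx = JAx = −(γ/2)Jx`, `J²x = −x_h`, `⟪x_h, Jx⟫ = 0`, `⟪x_h, Ax⟫ = −(γ/2)ρ`);
* `Δv = 4(ρq'' + 2q')(ρ) Jx` (`laplacian_azimuthal`, via the tree's `laplacian_smul_rotGen` and the
  radial chain rule `laplacian_comp_rho`: `Δ(g∘ρ) = 4ρg'' + 4g'`), `ΔA = 0`;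
* the pressure `p = −½|Ax|² + ½∫₀^ρ q²` (strain pressure + cyclostrophic balance `∂ᵣp = v_θ²/r`)
  has `∇p = −A²x + q(ρ)² x_h` (`gradient_pressure`);

so that the steady momentum equation reduces to the scalar ODE

  `4ν(ρq'' + 2q') + γ(q + ρq') = 0`      (`isSteadyClassicalNS_azimuthal`).

Its decaying solutions `q = c·a φ(aρ)`-type, `a = γ/4ν`, give the Burgers vortex
(`BurgersVortexSteady`); this file is the profile-independent part (Burgers 1948; Frisch 1995,
§8.9.1; Gallay–Maekawa 2016, (1.19)–(1.22)).

## References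

* J. M. Burgers, Adv. Appl. Mech. 1 (1948) 171–199.
* U. Frisch, *Turbulence* (1995), §8.9.1. [Frisch1995]
* Th. Gallay, Y. Maekawa, arXiv:1610.08384, (1.19)–(1.22). [GallayMaekawa2016]
-/

noncomputable section

open Set Function Filter Topology WithLp MeasureTheory InnerProductSpace
open scoped Laplacian RealInnerProductSpace ContDiff

namespace Literature.Analysis.FluidPDE

/-- Local notation for physical space `ℝ³ = EuclideanSpace ℝ (Fin 3)`. -/
local notation "ℝ³" => EuclideanSpace ℝ (Fin 3)

namespace StrainedAzimuthal

/-! ### The horizontal radius squared `ρ = x₀² + x₁²` and its calculus -/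

/-- The horizontal position vector `x_h = (x₀, x₁, 0)`. [folklore] -/
def hor (x : ℝ³) : ℝ³ :=
  toLp 2 ![x 0, x 1, 0]

/-- Components of `x_h`. [folklore] -/
@[simp] theorem hor_apply_zero (x : ℝ³) : hor x 0 = x 0 := rfl

/-- Components of `x_h`. [folklore] -/
@[simp] theorem hor_apply_one (x : ℝ³) : hor x 1 = x 1 := rfl

/-- Components of `x_h`. [folklore] -/
@[simp] theorem hor_apply_two (x : ℝ³) : hor x 2 = 0 := rfl

/-- The horizontal radius squared `ρ(x) = x₀² + x₁²`. [folklore] -/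
def rho (x : ℝ³) : ℝ :=
  x 0 ^ 2 + x 1 ^ 2

/-- Unfolding `ρ`. [folklore] -/
theorem rho_apply (x : ℝ³) : rho x = x 0 ^ 2 + x 1 ^ 2 := rfl

/-- The coordinate projections as continuous linear maps. [folklore] -/
abbrev proj (i : Fin 3) : ℝ³ →L[ℝ] ℝ :=
  EuclideanSpace.proj i

/-- The derivative of `ρ`: `Dρ(x) = 2x₀ dx₀ + 2x₁ dx₁`. [folklore] -/
def rhoDeriv (x : ℝ³) : ℝ³ →L[ℝ] ℝ :=
  (2 * x 0) • proj 0 + (2 * x 1) • proj 1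

/-- `Dρ(x) h = 2(x₀h₀ + x₁h₁)`. [folklore] -/
@[simp] theorem rhoDeriv_apply (x h : ℝ³) : rhoDeriv x h = 2 * (x 0 * h 0 + x 1 * h 1) := by
  simp [rhoDeriv]; ring

/-- `ρ` is differentiable with derivative `rhoDeriv`. [folklore] -/
theorem hasFDerivAt_rho (x : ℝ³) : HasFDerivAt rho (rhoDeriv x) x := by
  have h0 : HasFDerivAt (fun y : ℝ³ => y 0) (proj 0) x := (proj 0).hasFDerivAt
  have h1 : HasFDerivAt (fun y : ℝ³ => y 1) (proj 1) x := (proj 1).hasFDerivAt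
  refine ((h0.pow 2).fun_add (h1.pow 2)).congr_fderiv ?_
  ext h
  simp only [_root_.add_apply, _root_.smul_apply, smul_eq_mul,
    rhoDeriv_apply, PiLp.proj_apply, nsmul_eq_mul, Nat.cast_ofNat, pow_one, Nat.add_one_sub_one]
  ring

/-- `ρ` is smooth. [folklore] -/
theorem contDiff_rho {n : WithTop ℕ∞} : ContDiff ℝ n rho :=
  ((contDiff_piLp_apply (p := 2) (i := (0 : Fin 3))).pow 2).add
    ((contDiff_piLp_apply (p := 2) (i := (1 : Fin 3))).pow 2)

section RadialCalculus

variable {g g' g'' : ℝ → ℝ}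

/-- **Chain rule through `ρ`**: `D(g∘ρ)(x) h = g'(ρ) · 2(x₀h₀ + x₁h₁)`. [folklore] -/
theorem hasFDerivAt_comp_rho (hg : ∀ t, HasDerivAt g (g' t) t) (x : ℝ³) :
    HasFDerivAt (fun y => g (rho y)) (g' (rho x) • rhoDeriv x) x :=
  (hg (rho x)).comp_hasFDerivAt x (hasFDerivAt_rho x)

/-- The derivative of `g ∘ ρ` applied to a vector. [folklore] -/
theorem fderiv_comp_rho_apply (hg : ∀ t, HasDerivAt g (g' t) t) (x h : ℝ³) :
    fderiv ℝ (fun y => g (rho y)) x h = g' (rho x) * (2 * (x 0 * h 0 + x 1 * h 1)) := by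
  rw [(hasFDerivAt_comp_rho hg x).fderiv]
  simp

/-- `g ∘ ρ` is differentiable. [folklore] -/
theorem differentiable_comp_rho (hg : ∀ t, HasDerivAt g (g' t) t) :
    Differentiable ℝ (fun y => g (rho y)) :=
  fun x => (hasFDerivAt_comp_rho hg x).differentiableAt

/-- **Gradient through `ρ`**: `∇(g∘ρ)(x) = 2g'(ρ) x_h`. [folklore] -/
theorem gradient_comp_rho (hg : ∀ t, HasDerivAt g (g' t) t) (x : ℝ³) :
    gradient (fun y => g (rho y)) x = (2 * g' (rho x)) • hor x := by
  refine HasGradientAt.gradient ?_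
  rw [hasGradientAt_iff_hasFDerivAt]
  refine (hasFDerivAt_comp_rho hg x).congr_fderiv ?_
  ext h
  rw [toDual_apply_apply]
  simp only [_root_.smul_apply, rhoDeriv_apply, smul_eq_mul, hor, PiLp.inner_apply,
    Fin.sum_univ_three, PiLp.smul_apply, RCLike.inner_apply, conj_trivial]
  simp
  ring

/-- Partial derivatives of `g ∘ ρ`: `∂₀(g∘ρ) = 2x₀ g'(ρ)`. [folklore] -/
theorem fderiv_comp_rho_single_zero (hg : ∀ t, HasDerivAt g (g' t) t) (y : ℝ³) :
    fderiv ℝ (fun y => g (rho y)) y (EuclideanSpace.single 0 1) = g' (rho y) * (2 * y 0) := by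
  rw [fderiv_comp_rho_apply hg]; simp

/-- Partial derivatives of `g ∘ ρ`: `∂₁(g∘ρ) = 2x₁ g'(ρ)`. [folklore] -/
theorem fderiv_comp_rho_single_one (hg : ∀ t, HasDerivAt g (g' t) t) (y : ℝ³) :
    fderiv ℝ (fun y => g (rho y)) y (EuclideanSpace.single 1 1) = g' (rho y) * (2 * y 1) := by
  rw [fderiv_comp_rho_apply hg]; simp

/-- Partial derivatives of `g ∘ ρ`: `∂₂(g∘ρ) = 0`. [folklore] -/
theorem fderiv_comp_rho_single_two (hg : ∀ t, HasDerivAt g (g' t) t) (y : ℝ³) :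
    fderiv ℝ (fun y => g (rho y)) y (EuclideanSpace.single 2 1) = 0 := by
  rw [fderiv_comp_rho_apply hg]; simp

/-- Second partials: `∂ᵢ(2xᵢ g'(ρ)) = 4xᵢ² g''(ρ) + 2g'(ρ)` for a horizontal index `i`. [folklore] -/
theorem fderiv_mul_coord_comp_rho (hg' : ∀ t, HasDerivAt g' (g'' t) t) (x : ℝ³) {i : Fin 3}
    (hi : i = 0 ∨ i = 1) :
    fderiv ℝ (fun y : ℝ³ => g' (rho y) * (2 * y i)) x (EuclideanSpace.single i 1) =
      g'' (rho x) * (2 * x i) * (2 * x i) + g' (rho x) * 2 := by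
  have hlin : HasFDerivAt (fun y : ℝ³ => (2 : ℝ) * y i) ((2 : ℝ) • proj i) x :=
    (proj i).hasFDerivAt.const_mul (2 : ℝ)
  rw [((hasFDerivAt_comp_rho hg' x).fun_mul hlin).fderiv]
  rcases hi with rfl | rfl <;> simp <;> ring

/-- **Laplacian through `ρ`**: `Δ(g∘ρ)(x) = 4ρ g''(ρ) + 4 g'(ρ)` (two horizontal directions,
`|∇ρ|² = 4ρ`, `Δρ = 4`). [folklore] -/
theorem laplacian_comp_rho (hg2 : ContDiff ℝ 2 g) (hg : ∀ t, HasDerivAt g (g' t) t)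
    (hg' : ∀ t, HasDerivAt g' (g'' t) t) (x : ℝ³) :
    Δ (fun y => g (rho y)) x = 4 * rho x * g'' (rho x) + 4 * g' (rho x) := by
  have hc : ContDiff ℝ 2 (fun y => g (rho y)) := hg2.comp contDiff_rho
  rw [laplacian_eq_sum_fderiv_fderiv (EuclideanSpace.basisFun (Fin 3) ℝ) hc x]
  simp only [Fin.sum_univ_three, EuclideanSpace.basisFun_apply, fderiv_comp_rho_single_zero hg,
    fderiv_comp_rho_single_one hg, fderiv_comp_rho_single_two hg, fderiv_fun_const, Pi.zero_apply,
    _root_.zero_apply, add_zero]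
  rw [fderiv_mul_coord_comp_rho hg' x (Or.inl rfl), fderiv_mul_coord_comp_rho hg' x (Or.inr rfl),
    rho_apply]
  ring

end RadialCalculus

/-! ### Azimuthal fields `q(ρ) J x` in the axisymmetric strain: the abstract computation -/

section Profile

variable {γ ν : ℝ} {q q' q'' : ℝ → ℝ}

/-- The strain matrix `A = diag(−γ/2, −γ/2, γ)` as a continuous linear map. [folklore] -/
abbrev strainL (γ : ℝ) : ℝ³ →L[ℝ] ℝ³ :=
  linearStrainL (-γ / 2) (-γ / 2) γ

/-- `axisymmetricStrain γ = strainL γ` as functions. [folklore] -/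
theorem axisymmetricStrain_eq (γ : ℝ) : axisymmetricStrain γ = fun x => strainL γ x := rfl

/-- The azimuthal field with radial profile `q`: `v(x) = q(ρ(x)) J x`. [folklore] -/
def azimuthal (q : ℝ → ℝ) (x : ℝ³) : ℝ³ :=
  q (rho x) • rotGen x

/-- The pressure of the strained azimuthal flow:
`p(x) = −½|Ax|² + ½ ∫₀^{ρ(x)} q(τ)² dτ` (strain pressure plus cyclostrophic balance). [folklore] -/
def pressure (γ : ℝ) (q : ℝ → ℝ) (x : ℝ³) : ℝ :=
  -2⁻¹ * ‖strainL γ x‖ ^ 2 + 2⁻¹ * ∫ τ in (0 : ℝ)..rho x, q τ ^ 2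

/-- The azimuthal field is smooth if its profile is. [folklore] -/
theorem contDiff_azimuthal (hq : ContDiff ℝ ∞ q) : ContDiff ℝ ∞ (azimuthal q) :=
  (hq.comp contDiff_rho).smul contDiff_rotGen

/-- The derivative of the azimuthal field: `Dv(x) h = 2q'(ρ)(x₀h₀ + x₁h₁) Jx + q(ρ) Jh`. [folklore] -/
theorem fderiv_azimuthal_apply (hq : ∀ σ, HasDerivAt q (q' σ) σ) (x h : ℝ³) :
    fderiv ℝ (azimuthal q) x h =
      (q' (rho x) * (2 * (x 0 * h 0 + x 1 * h 1))) • rotGen x + q (rho x) • rotGen h := by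
  change fderiv ℝ (fun y => q (rho y) • rotGen y) x h = _
  rw [fderiv_smul_rotGen_apply ((differentiable_comp_rho hq) x), fderiv_comp_rho_apply hq]

/-- The Laplacian of the azimuthal field: `Δv(x) = (4ρq'' + 4q')(ρ) Jx + 2 J(2q'(ρ) x_h)`. [folklore] -/
theorem laplacian_azimuthal (hq2 : ContDiff ℝ 2 q) (hq : ∀ σ, HasDerivAt q (q' σ) σ)
    (hq' : ∀ σ, HasDerivAt q' (q'' σ) σ) (x : ℝ³) :
    Δ (azimuthal q) x =
      (4 * rho x * q'' (rho x) + 4 * q' (rho x)) • rotGen x +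
        (2 : ℝ) • rotGen ((2 * q' (rho x)) • hor x) := by
  have h : azimuthal q = fun y => q (rho y) • rotGen y := rfl
  have hc : ContDiff ℝ 2 (fun y => q (rho y)) := hq2.comp contDiff_rho
  rw [h, laplacian_smul_rotGen hc x, laplacian_comp_rho hq2 hq hq' x, gradient_comp_rho hq x]

/-- The Laplacian of a linear strain vanishes. [folklore] -/
theorem laplacian_linearStrainL (γ₁ γ₂ γ₃ : ℝ) (x : ℝ³) :
    Δ (fun y => linearStrainL γ₁ γ₂ γ₃ y) x = 0 := by
  rw [laplacian_eq_sum_fderiv_fderiv (stdOrthonormalBasis ℝ ℝ³) (linearStrainL γ₁ γ₂ γ₃).contDiff x]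
  refine Finset.sum_eq_zero fun i _ => ?_
  have h : (fun y => fderiv ℝ (fun y => linearStrainL γ₁ γ₂ γ₃ y) y (stdOrthonormalBasis ℝ ℝ³ i)) =
      fun _ => linearStrainL γ₁ γ₂ γ₃ (stdOrthonormalBasis ℝ ℝ³ i) := by
    funext y; rw [(linearStrainL γ₁ γ₂ γ₃).fderiv]
  rw [h, fderiv_fun_const, Pi.zero_apply, _root_.zero_apply]

/-- The Laplacian of the axisymmetric strain vanishes. [folklore] -/
theorem laplacian_strainL (γ : ℝ) (x : ℝ³) : Δ (fun y => strainL γ y) x = 0 :=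
  laplacian_linearStrainL _ _ _ x

/-- `A(Jx) = −(γ/2) Jx`. [folklore] -/
theorem strainL_rotGen (γ : ℝ) (x : ℝ³) : strainL γ (rotGen x) = (-γ / 2) • rotGen x := by
  ext i; fin_cases i <;> simp [rotGen, linearStrain]

/-- `J(Ax) = −(γ/2) Jx`. [folklore] -/
theorem rotGen_strainL (γ : ℝ) (x : ℝ³) : rotGen (strainL γ x) = (-γ / 2) • rotGen x := by
  ext i; fin_cases i <;> simp [rotGen, linearStrain]

/-- `J(Jx) = −x_h`. [folklore] -/
theorem rotGen_rotGen (x : ℝ³) : rotGen (rotGen x) = -hor x := by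
  ext i; fin_cases i <;> simp [rotGen, hor]

/-- `J(x_h) = Jx`. [folklore] -/
theorem rotGen_hor (x : ℝ³) : rotGen (hor x) = rotGen x := by
  ext i; fin_cases i <;> simp [rotGen, hor]

/-- The gradient of the strain pressure `−½|Mx|²` of a linear strain `M = diag(γ₁, γ₂, γ₃)` is
`−M(Mx)` (`M` is symmetric). [folklore] -/
theorem hasGradientAt_linearStrainPressure (γ₁ γ₂ γ₃ : ℝ) (x : ℝ³) :
    HasGradientAt (fun y : ℝ³ => -2⁻¹ * ‖linearStrainL γ₁ γ₂ γ₃ y‖ ^ 2)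
      (-(linearStrainL γ₁ γ₂ γ₃ (linearStrainL γ₁ γ₂ γ₃ x))) x := by
  rw [hasGradientAt_iff_hasFDerivAt]
  have h := ((linearStrainL γ₁ γ₂ γ₃).hasFDerivAt (x := x)).norm_sq.const_mul (-2⁻¹ : ℝ)
  refine h.congr_fderiv ?_
  ext h
  rw [toDual_apply_apply]
  simp only [_root_.smul_apply, ContinuousLinearMap.comp_apply, innerSL_apply_apply, smul_eq_mul,
    PiLp.inner_apply, Fin.sum_univ_three, RCLike.inner_apply, conj_trivial, linearStrainL_apply,
    linearStrain_apply_zero, linearStrain_apply_one, linearStrain_apply_two, PiLp.neg_apply,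
    nsmul_eq_mul, Nat.cast_ofNat]
  ring

/-- The gradient of the strain pressure `−½|Ax|²` is `−A(Ax)` (`A` is symmetric). [folklore] -/
theorem hasGradientAt_strainPressure (γ : ℝ) (x : ℝ³) :
    HasGradientAt (fun y : ℝ³ => -2⁻¹ * ‖strainL γ y‖ ^ 2) (-(strainL γ (strainL γ x))) x :=
  hasGradientAt_linearStrainPressure _ _ _ x

/-- The cyclostrophic pressure `½∫₀^{ρ} q²` has gradient `q(ρ)² x_h`. [folklore] -/
theorem hasGradientAt_cycloPressure (hqc : Continuous q) (x : ℝ³) :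
    HasGradientAt (fun y : ℝ³ => 2⁻¹ * ∫ τ in (0 : ℝ)..rho y, q τ ^ 2) (q (rho x) ^ 2 • hor x) x := by
  have hQ : ∀ σ, HasDerivAt (fun σ => 2⁻¹ * ∫ τ in (0 : ℝ)..σ, q τ ^ 2) (2⁻¹ * q σ ^ 2) σ := fun σ =>
    ((hqc.pow 2).integral_hasStrictDerivAt 0 σ).hasDerivAt.const_mul 2⁻¹
  have hg := gradient_comp_rho hQ x
  have hd : DifferentiableAt ℝ (fun y : ℝ³ => 2⁻¹ * ∫ τ in (0 : ℝ)..rho y, q τ ^ 2) x :=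
    (hasFDerivAt_comp_rho hQ x).differentiableAt
  rw [show q (rho x) ^ 2 • hor x = (2 * (2⁻¹ * q (rho x) ^ 2)) • hor x by ring_nf, ← hg]
  exact hd.hasGradientAt

/-- **The gradient of the pressure**: `∇p(x) = −A(Ax) + q(ρ)² x_h`. [folklore] -/
theorem gradient_pressure (hqc : Continuous q) (γ : ℝ) (x : ℝ³) :
    gradient (pressure γ q) x = -(strainL γ (strainL γ x)) + q (rho x) ^ 2 • hor x := by
  have h := (hasGradientAt_strainPressure γ x).hasFDerivAt.add
    (hasGradientAt_cycloPressure hqc x).hasFDerivAt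
  rw [← map_add] at h
  exact (hasGradientAt_iff_hasFDerivAt.2 h).gradient

/-- The pressure is smooth when the profile is. [folklore] -/
theorem contDiff_pressure (hq : ContDiff ℝ ∞ q) (γ : ℝ) : ContDiff ℝ ∞ (pressure γ q) := by
  have hQ : ContDiff ℝ ∞ (fun σ => ∫ τ in (0 : ℝ)..σ, q τ ^ 2) := by
    have hder : ∀ σ, HasDerivAt (fun σ => ∫ τ in (0 : ℝ)..σ, q τ ^ 2) (q σ ^ 2) σ := fun σ =>
      ((hq.continuous.pow 2).integral_hasStrictDerivAt 0 σ).hasDerivAt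
    rw [contDiff_infty_iff_deriv]
    refine ⟨fun σ => (hder σ).differentiableAt, ?_⟩
    rw [show deriv (fun σ => ∫ τ in (0 : ℝ)..σ, q τ ^ 2) = fun σ => q σ ^ 2 from
      funext fun σ => (hder σ).deriv]
    exact hq.pow 2
  unfold pressure
  exact (contDiff_const.mul ((contDiff_norm_sq ℝ).comp (strainL γ).contDiff)).add
    (contDiff_const.mul (hQ.comp contDiff_rho))

/-- **Steady Navier–Stokes for strained azimuthal profiles.** If the smooth radial profile `q`
satisfies the ODE `4ν(σq'' + 2q') + γ(q + σq') = 0`, then `U_s + q(ρ)Jx` with the pressure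
`pressure γ q` is a steady classical solution of the unforced Navier–Stokes equations with
viscosity `ν` (the computation behind Burgers 1948 / Frisch 1995 (8.140)). [folklore] -/
theorem isSteadyClassicalNS_azimuthal (hqs : ContDiff ℝ ∞ q) (hq : ∀ σ, HasDerivAt q (q' σ) σ)
    (hq' : ∀ σ, HasDerivAt q' (q'' σ) σ)
    (hode : ∀ σ, 4 * ν * (σ * q'' σ + 2 * q' σ) + γ * (q σ + σ * q' σ) = 0) :
    IsSteadyClassicalNS ν 0 (axisymmetricStrain γ + azimuthal q) (pressure γ q) where
  smooth_velocity := (contDiff_axisymmetricStrain γ).add (contDiff_azimuthal hqs)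
  smooth_pressure := contDiff_pressure hqs γ
  momentum x := by
    have hU : fderiv ℝ (axisymmetricStrain γ) x = strainL γ :=
      (hasFDerivAt_linearStrain _ _ _ x).fderiv
    have hdU : DifferentiableAt ℝ (axisymmetricStrain γ) x :=
      (hasFDerivAt_linearStrain _ _ _ x).differentiableAt
    have hdv : DifferentiableAt ℝ (azimuthal q) x :=
      ((contDiff_azimuthal hqs).differentiable (by simp)) x
    -- convective term
    have hconv : convect (axisymmetricStrain γ + azimuthal q) (axisymmetricStrain γ + azimuthal q) x =
        strainL γ (strainL γ x) + q (rho x) • strainL γ (rotGen x) +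
          ((q' (rho x) * (2 * (x 0 * (strainL γ x) 0 + x 1 * (strainL γ x) 1))) • rotGen x +
            q (rho x) • rotGen (strainL γ x)) +
          q (rho x) • ((q' (rho x) * (2 * (x 0 * (rotGen x) 0 + x 1 * (rotGen x) 1))) • rotGen x +
            q (rho x) • rotGen (rotGen x)) := by
      rw [convect_apply, fderiv_add hdU hdv, hU]
      simp only [Pi.add_apply, _root_.add_apply, map_add, map_smul, fderiv_azimuthal_apply hq,
        axisymmetricStrain_eq, azimuthal, smul_add]
      abel
    -- Laplacian
    have hlap : Δ (axisymmetricStrain γ + azimuthal q) x =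
        (4 * rho x * q'' (rho x) + 4 * q' (rho x)) • rotGen x +
          (2 : ℝ) • rotGen ((2 * q' (rho x)) • hor x) := by
      rw [ContDiffAt.laplacian_add ((contDiff_axisymmetricStrain γ).contDiffAt)
        (((contDiff_azimuthal hqs).of_le (by norm_cast)).contDiffAt),
        axisymmetricStrain_eq, laplacian_strainL, zero_add,
        laplacian_azimuthal (hqs.of_le (by norm_cast)) hq hq' x]
    have hgrad := gradient_pressure (q := q) hqs.continuous γ x
    rw [hconv, hlap, hgrad, strainL_rotGen, rotGen_strainL, rotGen_rotGen, rotGen_smul, rotGen_hor]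
    have hode' := hode (rho x)
    simp only [rho_apply] at hode' ⊢
    ext i
    fin_cases i
    · simp [rotGen, hor, linearStrain]
      linear_combination (x 1) * hode'
    · simp [rotGen, hor, linearStrain]
      linear_combination (-(x 0)) * hode'
    · simp [rotGen, hor, linearStrain]
  divFree x := by
    have hU : fderiv ℝ (axisymmetricStrain γ) x = strainL γ :=
      (hasFDerivAt_linearStrain _ _ _ x).fderiv
    have hdU : DifferentiableAt ℝ (axisymmetricStrain γ) x :=
      (hasFDerivAt_linearStrain _ _ _ x).differentiableAt
    have hdv : DifferentiableAt ℝ (azimuthal q) x :=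
      ((contDiff_azimuthal hqs).differentiable (by simp)) x
    rw [divergence_eq_sum_inner_fderiv (EuclideanSpace.basisFun (Fin 3) ℝ), fderiv_add hdU hdv, hU]
    simp only [Fin.sum_univ_three, EuclideanSpace.basisFun_apply, _root_.add_apply,
      fderiv_azimuthal_apply hq, EuclideanSpace.inner_single_left, map_one, one_mul]
    simp [rotGen, linearStrain]
    ring

end Profile

end StrainedAzimuthal

end Literature.Analysis.FluidPDE
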